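import Literature.Analysis.PDE.TorusWordCalculus
import HarnessLib

/-!
# Crude Moser-type commutator estimates on `𝕋³`: `‖[∂^w, G(V)] ∂ⱼU‖_{L²}` at every order
# (topic `Analysis/PDE`)

Analysis/PDE support file (everything proved; one definition with a body, no named facts) of
the energy method for quasilinear symmetric hyperbolic systems on `𝕋³` (Dafermos 2005,
Thm 5.1.1; Majda 1984, Ch. 2, Thm 2.1), towards the named fact
`Literature.MathematicalPhysics.KineticTheory.hsEuler_localExistence`. Applying `∂^w` to the
linearised system `∂ₜU + Σⱼ ãⱼ(V) ∂ⱼU = 0` produces the commutators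

  `tcomm G V w g = ∂^w (G(V) g) - G(V) ∂^w g = Σ_{(a,c) ∈ splittings w, a ≠ []} ∂^a(G ∘ V) ∂^c g`

(`g = ∂ⱼU`, `G = ãⱼ` a smooth operator-valued map of the state). This file proves the two
`L²(𝕋³)` bounds on them that drive Majda's scheme [Majda1984, Ch. 2, proof of Thm 2.1;
Prop. 2.1 (2.1)–(2.2) in the crude form in which every factor but the one of highest order is
taken in the sup norm, so that no Gagliardo–Nirenberg interpolation is needed]:

* `exists_tcomm_sq_integral_le` (**base level**, `m ≥ 6`): if `twordEnergy m V ≤ E₀` then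
  `∫ ‖[∂^w, G(V)] ∂ⱼU‖² ≤ C(G, m, E₀) · twordEnergy m U` for `|w| ≤ m` — LINEAR in the level-`m`
  energy of `U`, constants depending on the level-`m` energy bound of the coefficient field;
* `exists_tcomm_sq_integral_le_step` (**regularity step**, `m ≥ 8`): if
  `twordEnergy (m-1) V, twordEnergy (m-1) U ≤ E₀` then
  `∫ ‖[∂^w, G(V)] ∂ⱼU‖² ≤ C · (twordEnergy m U + twordEnergy m V + 1)` for `|w| ≤ m` — linear
  in the level-`m` energies of BOTH fields with constants from the level-`(m-1)` bounds (the
  estimate that propagates higher regularity on a fixed time interval);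
* `exists_sup_iterPartialDeriv_comp_le` — sup bounds `‖∂^v (G ∘ V)(x)‖ ≤ C(G, m, E₀)` for
  `|v| + 2 ≤ m` under `twordEnergy m V ≤ E₀` (coefficients, their first derivatives, `A₀(V)`).

Proof: the Leibniz expansion in commutator form (`iterPartialDeriv_clm_apply_eq`) is lifted to
`[0,1]³ ⊂ ℝ³` (`lift_tcomm_eq`); a term `∂^a(G∘V) ∂^c ∂ⱼU` with few derivatives on `V` is
bounded by `sup ‖∂^a(G∘V)‖ · ‖∂^c∂ⱼU‖_{L²}` (the tree's `exists_sup_bound_cwd_comp` and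
`H²(𝕋³) ⊂ L^∞`), one with many derivatives on `V` by `‖∂^a(G∘V)‖_{L²} · sup ‖∂^c∂ⱼU‖` (the
tree's tame bound `exists_tame_bound_cwd_comp` and `H² ⊂ L^∞` again); the thresholds are
arranged so that every sup norm is two derivatives below an available energy.

## Mathlib / tree search

Tree: `exists_sup_bound_cwd_comp`, `exists_tame_bound_cwd_comp`, `l2On_le_mul_of_le`,
`l2On_list_sum_le`, `length_splittings` (`CoordWordTame`), `splittings_eq_cons`
(`CoordWordDeriv`), the dictionary `TorusWordCalculus`. No torus commutator estimate of this
kind (`TorusCommutatorEstimate`/`TorusCommutatorAllOrders` are mollifier commutators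
`[J_ε, a]`; `lean search 'tcomm|Moser.*torus|commutator.*iterPartialDeriv'`).

## References

* A. Majda, *Compressible Fluid Flow and Systems of Conservation Laws in Several Space
  Variables*, Springer 1984, Ch. 2 §2.1, Thm 2.1 and Prop. 2.1. [`Majda1984`]
* M. E. Taylor, *Partial Differential Equations III*, 2nd ed., Springer 2011, Ch. 13 §3,
  Props. 3.6–3.9 (Moser estimates); Ch. 16 §1. [`TaylorPDEIII2011`]
* C. M. Dafermos, *Hyperbolic Conservation Laws in Continuum Physics*, 2nd ed., Springer 2005,
  §5.1, proof of Thm 5.1.1 ((5.1.13)–(5.1.16)). [`Dafermos2005`]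
-/

noncomputable section

open MeasureTheory Set Filter Function
open scoped ContDiff InnerProductSpace Topology ENNReal

namespace Literature.Analysis.PDE

open Literature.Analysis.FunctionSpaces Literature.Analysis.FunctionSpaces.Torus

universe u

variable {ι : Type*} [Fintype ι] [DecidableEq ι]
variable {W W' : Type u} [NormedAddCommGroup W] [NormedSpace ℝ W] [NormedAddCommGroup W']
  [NormedSpace ℝ W']

/-! ## The commutator and its lifted Leibniz expansion -/

/-- **The commutator `[∂^w, G(V)] g = ∂^w (G(V) g) - G(V) ∂^w g`** of a word derivative with
multiplication by the composite operator field `x ↦ G (V x)`.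
[cite: Majda1984, Ch. 2 §2.1, proof of Thm 2.1] -/
def tcomm (G : W → (W →L[ℝ] W')) (V : UnitAddTorus ι → W) (w : List ι) (g : UnitAddTorus ι → W)
    (x : UnitAddTorus ι) : W' :=
  iterPartialDeriv w (fun y => G (V y) (g y)) x - G (V x) (iterPartialDeriv w g x)

omit [Fintype ι] in
/-- Unfolding. [folklore] -/
theorem tcomm_apply (G : W → (W →L[ℝ] W')) (V : UnitAddTorus ι → W) (w : List ι)
    (g : UnitAddTorus ι → W) (x : UnitAddTorus ι) :
    tcomm G V w g x = iterPartialDeriv w (fun y => G (V y) (g y)) x - G (V x) (iterPartialDeriv w g x) :=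
  rfl

/-- The commutator of smooth data is smooth. [folklore] -/
theorem isSmooth_tcomm {G : W → (W →L[ℝ] W')} (hG : ContDiff ℝ ∞ G) {V : UnitAddTorus ι → W}
    (hV : IsSmooth V) (w : List ι) {g : UnitAddTorus ι → W} (hg : IsSmooth g) :
    IsSmooth (tcomm G V w g) := by
  have hC : IsSmooth fun x => G (V x) := isSmooth_comp hG hV
  exact ((isSmooth_clm_apply hC hg).iterPartialDeriv w).sub (isSmooth_clm_apply hC (hg.iterPartialDeriv w))

/-- **Lifted Leibniz expansion of the commutator**: with `splittings w = ([], w) :: r`,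
`lift ([∂^w, G(V)] g) = Σ_{(a,c) ∈ r} cwd a (G ∘ lift V) · cwd c (lift g)`.
[cite: Majda1984, Ch. 2 §2.1, proof of Thm 2.1] -/
theorem lift_tcomm_eq {G : W → (W →L[ℝ] W')} (hG : ContDiff ℝ ∞ G) {V : UnitAddTorus ι → W}
    (hV : IsSmooth V) {g : UnitAddTorus ι → W} (hg : IsSmooth g) {w : List ι}
    {r : List (List ι × List ι)} (hr : splittings w = ([], w) :: r) :
    lift (tcomm G V w g) = fun y =>
      (r.map fun p => cwd p.1 (fun z => G (lift V z)) y (cwd p.2 (lift g) y)).sum := by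
  have hC : IsSmooth fun x => G (V x) := isSmooth_comp hG hV
  have h := iterPartialDeriv_clm_apply_eq hC hg hr
  funext y
  rw [lift_apply, tcomm_apply, h]
  simp only [add_sub_cancel_left]
  congr 1
  refine List.map_congr_left fun p _ => ?_
  rw [iterPartialDeriv_apply_proj hC, iterPartialDeriv_apply_proj hg]
  rfl

/-! ## The two elementary term bounds -/

omit [DecidableEq ι] in
/-- **Sup × `L²`**: `‖𝟙_K (A u)‖_{L²} ≤ C₁ ‖𝟙_K u‖_{L²}` if `‖A‖ ≤ C₁` on `K`. [folklore] -/
theorem l2On_clm_apply_le_of_norm_le {K : Set (EuclideanSpace ℝ ι)} (hK : IsCompact K)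
    {A : EuclideanSpace ℝ ι → (W →L[ℝ] W')} {u : EuclideanSpace ℝ ι → W} {C₁ : ℝ}
    (hA : ∀ y ∈ K, ‖A y‖ ≤ C₁) (hC₁ : 0 ≤ C₁) (hu : Continuous u) :
    l2On K (fun y => A y (u y)) ≤ C₁ * l2On K u :=
  l2On_le_mul_of_le hK hu hC₁ fun y hy =>
    (ContinuousLinearMap.le_opNorm _ _).trans (mul_le_mul_of_nonneg_right (hA y hy) (norm_nonneg _))

omit [DecidableEq ι] in
/-- **`L²` × sup**: `‖𝟙_K (A u)‖_{L²} ≤ s ‖𝟙_K A‖_{L²}` if `‖u‖ ≤ s` everywhere. [folklore] -/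
theorem l2On_clm_apply_le_of_norm_le_right {K : Set (EuclideanSpace ℝ ι)} (hK : IsCompact K)
    {A : EuclideanSpace ℝ ι → (W →L[ℝ] W')} {u : EuclideanSpace ℝ ι → W} {s : ℝ}
    (hA : Continuous A) (hu : ∀ y, ‖u y‖ ≤ s) (hs : 0 ≤ s) :
    l2On K (fun y => A y (u y)) ≤ s * l2On K A :=
  l2On_le_mul_of_le hK hA hs fun y _ => (ContinuousLinearMap.le_opNorm _ _).trans (by
    rw [mul_comm]
    exact mul_le_mul_of_nonneg_right (hu y) (norm_nonneg _))

/-! ## Sup bounds for composites -/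

section Sup

variable [FiniteDimensional ℝ W]

/-- **Sup bounds for the word derivatives of a composite** `x ↦ G (V x)` two orders below the
energy level: under `twordEnergy m V ≤ E₀`, `‖∂^v (G ∘ V)(x)‖ ≤ C(G, m, E₀)` for `|v| + 2 ≤ m`
(`H² ⊂ L^∞` on `𝕋³` and the tree's `exists_sup_bound_cwd_comp`).
[cite: Majda1984, Ch. 2 §2.1, Prop. 2.2] -/
theorem exists_sup_iterPartialDeriv_comp_le (hd : Fintype.card ι = 3) {X : Type u}
    [NormedAddCommGroup X] [NormedSpace ℝ X] {G : W → X} (hG : ContDiff ℝ ∞ G) (m : ℕ) (E₀ : ℝ) :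
    ∃ C : ℝ, 0 ≤ C ∧ ∀ V : UnitAddTorus ι → W, IsSmooth V → twordEnergy m V ≤ E₀ →
      ∀ v : List ι, v.length + 2 ≤ m → ∀ x, ‖iterPartialDeriv v (fun y => G (V y)) x‖ ≤ C := by
  obtain ⟨Cs, hCs0, hCs⟩ := exists_norm_sq_le_twordEnergy_two (F' := W) (ι := ι) hd
  have hK : IsCompact (closedCube ι) := isCompact_closedCube
  set F : EuclideanSpace ℝ ι × W → X := fun z => G z.2 with hF_def
  have hF : ContDiff ℝ ∞ F := hG.comp contDiff_snd
  obtain ⟨C₁, hC₁0, hC₁⟩ := exists_sup_bound_cwd_comp (ι := ι) (J := W) (m - 2) hF hK (√(Cs * E₀))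
  refine ⟨C₁, hC₁0, fun V hV hVE v hv x => ?_⟩
  have hVsup : ∀ c : List ι, c.length ≤ m - 2 → ∀ y ∈ closedCube ι, ‖cwd c (lift V) y‖ ≤ √(Cs * E₀) :=
    fun c hc y _ => (norm_cwd_lift_le_sqrt hCs hCs0.le hV (by omega) y).trans
      (Real.sqrt_le_sqrt (mul_le_mul_of_nonneg_left hVE hCs0.le))
  have hC : IsSmooth fun y => G (V y) := isSmooth_comp hG hV
  refine norm_le_of_forall_mem_closedCube (fun y hy => ?_) x
  rw [lift_iterPartialDeriv_eq_cwd hC]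
  exact hC₁ (lift V) hV hVsup v (by omega) y hy

end Sup

/-! ## The commutator estimates -/

section Commutator

variable [FiniteDimensional ℝ W]

omit [Fintype ι] [DecidableEq ι] [FiniteDimensional ℝ W] in
/-- The number of non-trivial splittings of a word of length `≤ m` is at most `2^m`. [folklore] -/
theorem length_le_two_pow_of_splittings_eq_cons {w : List ι} {r : List (List ι × List ι)}
    (hr : splittings w = ([], w) :: r) {m : ℕ} (hw : w.length ≤ m) : r.length ≤ 2 ^ m := by
  have h := length_splittings w
  rw [hr, List.length_cons] at h
  have h1 : r.length ≤ 2 ^ w.length := by omega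
  exact h1.trans (Nat.pow_le_pow_right two_pos hw)

/-- **Base-level commutator estimate** (`m ≥ 6` on `𝕋³`): for a smooth operator-valued `G` and
an energy bound `E₀` there is `C ≥ 0` such that for all smooth `V, U` with
`twordEnergy m V ≤ E₀`, all words `|w| ≤ m` and all `j`,

  `∫_𝕋 ‖[∂^w, G(V)] ∂ⱼU‖² ≤ C · twordEnergy m U`.

[cite: Majda1984, Ch. 2 §2.1, proof of Thm 2.1, Prop. 2.1 (2.2)] -/
theorem exists_tcomm_sq_integral_le (hd : Fintype.card ι = 3) {G : W → (W →L[ℝ] W')}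
    (hG : ContDiff ℝ ∞ G) {m : ℕ} (hm : 6 ≤ m) (E₀ : ℝ) :
    ∃ C : ℝ, 0 ≤ C ∧ ∀ V U : UnitAddTorus ι → W, IsSmooth V → IsSmooth U →
      twordEnergy m V ≤ E₀ → ∀ w ∈ wordsLE ι m, ∀ j : ι,
        ∫ x, ‖tcomm G V w (partialDeriv j U) x‖ ^ 2 ≤ C * twordEnergy m U := by
  obtain ⟨Cs, hCs0, hCs⟩ := exists_norm_sq_le_twordEnergy_two (F' := W) (ι := ι) hd
  have hK : IsCompact (closedCube ι) := isCompact_closedCube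
  set R₁ : ℝ := √(Cs * E₀) with hR₁_def
  set F : EuclideanSpace ℝ ι × W → (W →L[ℝ] W') := fun z => G z.2 with hF_def
  have hF : ContDiff ℝ ∞ F := hG.comp contDiff_snd
  obtain ⟨C₁, hC₁0, hC₁⟩ := exists_sup_bound_cwd_comp (ι := ι) (J := W) (m - 2) hF hK R₁
  obtain ⟨C₂, hC₂0, hC₂⟩ := exists_tame_bound_cwd_comp (ι := ι) (J := W) m hF hK R₁
  set T : ℝ := max C₁ (√Cs * (C₂ * (1 + √E₀))) with hT_def
  have hT0 : 0 ≤ T := hC₁0.trans (le_max_left _ _)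
  refine ⟨(2 ^ m * T) ^ 2, by positivity, fun V U hV hU hVE w hw j => ?_⟩
  have hwm : w.length ≤ m := mem_wordsLE.1 hw
  -- control of the coefficient field `V`
  have hVsup : ∀ c : List ι, c.length ≤ m - 2 → ∀ y ∈ closedCube ι, ‖cwd c (lift V) y‖ ≤ R₁ :=
    fun c hc y _ => (norm_cwd_lift_le_sqrt hCs hCs0.le hV (by omega) y).trans
      (Real.sqrt_le_sqrt (mul_le_mul_of_nonneg_left hVE hCs0.le))
  have hVsup' : ∀ c : List ι, c.length ≤ m / 2 + 1 → ∀ y ∈ closedCube ι, ‖cwd c (lift V) y‖ ≤ R₁ :=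
    fun c hc => hVsup c (by omega)
  have hVl2 : ∀ c : List ι, c.length ≤ m → l2On (closedCube ι) (cwd c (lift V)) ≤ √E₀ :=
    fun c hc => (l2On_cwd_lift_le_sqrt_twordEnergy hV hc).trans (Real.sqrt_le_sqrt hVE)
  have hGV : ContDiff ℝ ∞ fun y => G (lift V y) := hG.comp hV
  have h1 : ∀ v : List ι, v.length ≤ m - 2 → ∀ y ∈ closedCube ι,
      ‖cwd v (fun z => G (lift V z)) y‖ ≤ C₁ := hC₁ (lift V) hV hVsup
  have h2 : ∀ v : List ι, v.length ≤ m →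
      l2On (closedCube ι) (cwd v (fun z => G (lift V z))) ≤ C₂ * (1 + √E₀) :=
    hC₂ (lift V) hV hVsup' (√E₀) (Real.sqrt_nonneg _) hVl2
  -- control of `U`
  set EU : ℝ := twordEnergy m U with hEU_def
  have hEU0 : 0 ≤ EU := twordEnergy_nonneg m U
  have hUj : IsSmooth (partialDeriv j U) := hU.partialDeriv j
  have hcwdU : ∀ c : List ι, cwd c (lift (partialDeriv j U)) = cwd (c ++ [j]) (lift U) := fun c => by
    rw [lift_partialDeriv_eq_cwd (hU.isContDiff (by simp)), ← cwd_append]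
  have hUl2 : ∀ c : List ι, c.length + 1 ≤ m →
      l2On (closedCube ι) (cwd c (lift (partialDeriv j U))) ≤ √EU := fun c hc => by
    rw [hcwdU]
    exact l2On_cwd_lift_le_sqrt_twordEnergy hU (by simpa using hc)
  have hUsup : ∀ c : List ι, c.length + 3 ≤ m → ∀ y, ‖cwd c (lift (partialDeriv j U)) y‖ ≤ √(Cs * EU) :=
    fun c hc y => by
      rw [hcwdU]
      exact norm_cwd_lift_le_sqrt hCs hCs0.le hU (by simp; omega) y
  -- the expansion
  obtain ⟨r, hr, hne⟩ := splittings_eq_cons w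
  have hlen : ∀ p ∈ r, p.1.length + p.2.length = w.length := fun p hp =>
    length_add_length_of_mem_splittings (by rw [hr]; exact List.mem_cons_of_mem _ hp)
  have hrlen : r.length ≤ 2 ^ m := length_le_two_pow_of_splittings_eq_cons hr hwm
  have hlift := lift_tcomm_eq hG hV hUj hr
  -- each term
  have hterm : ∀ p ∈ r, l2On (closedCube ι)
      (fun y => cwd p.1 (fun z => G (lift V z)) y (cwd p.2 (lift (partialDeriv j U)) y)) ≤ T * √EU := by
    intro p hp
    have hp1 : 1 ≤ p.1.length := Nat.one_le_iff_ne_zero.2 fun h0 => hne p hp (List.eq_nil_of_length_eq_zero h0)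
    have hsum := hlen p hp
    by_cases hcase : p.1.length ≤ m - 2
    · calc l2On (closedCube ι)
            (fun y => cwd p.1 (fun z => G (lift V z)) y (cwd p.2 (lift (partialDeriv j U)) y))
          ≤ C₁ * l2On (closedCube ι) (cwd p.2 (lift (partialDeriv j U))) :=
            l2On_clm_apply_le_of_norm_le hK (h1 p.1 hcase) hC₁0 (continuous_cwd hUj _)
        _ ≤ C₁ * √EU := mul_le_mul_of_nonneg_left (hUl2 p.2 (by omega)) hC₁0
        _ ≤ T * √EU := mul_le_mul_of_nonneg_right (le_max_left _ _) (Real.sqrt_nonneg _)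
    · push Not at hcase
      calc l2On (closedCube ι)
            (fun y => cwd p.1 (fun z => G (lift V z)) y (cwd p.2 (lift (partialDeriv j U)) y))
          ≤ √(Cs * EU) * l2On (closedCube ι) (cwd p.1 (fun z => G (lift V z))) :=
            l2On_clm_apply_le_of_norm_le_right hK (continuous_cwd hGV _) (hUsup p.2 (by omega))
              (Real.sqrt_nonneg _)
        _ ≤ √(Cs * EU) * (C₂ * (1 + √E₀)) :=
            mul_le_mul_of_nonneg_left (h2 p.1 (by omega)) (Real.sqrt_nonneg _)
        _ = √Cs * (C₂ * (1 + √E₀)) * √EU := by rw [Real.sqrt_mul hCs0.le]; ring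
        _ ≤ T * √EU := mul_le_mul_of_nonneg_right (le_max_right _ _) (Real.sqrt_nonneg _)
  -- summation
  have hcont : ∀ p ∈ r, Continuous fun y =>
      cwd p.1 (fun z => G (lift V z)) y (cwd p.2 (lift (partialDeriv j U)) y) := fun p _ =>
    (continuous_cwd hGV _).clm_apply (continuous_cwd hUj _)
  have hl2 : l2On (closedCube ι) (lift (tcomm G V w (partialDeriv j U))) ≤ 2 ^ m * T * √EU := by
    rw [hlift]
    calc l2On (closedCube ι) (fun y =>
            (r.map fun p => cwd p.1 (fun z => G (lift V z)) y (cwd p.2 (lift (partialDeriv j U)) y)).sum)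
        ≤ (r.map fun p => l2On (closedCube ι)
            (fun y => cwd p.1 (fun z => G (lift V z)) y (cwd p.2 (lift (partialDeriv j U)) y))).sum :=
          l2On_list_sum_le hK r hcont
      _ ≤ (r.map fun _ => T * √EU).sum := List.sum_le_sum hterm
      _ = r.length * (T * √EU) := by simp [List.map_const', List.sum_replicate]
      _ ≤ 2 ^ m * (T * √EU) := mul_le_mul_of_nonneg_right (by exact_mod_cast hrlen) (by positivity)
      _ = 2 ^ m * T * √EU := by ring
  rw [← l2On_closedCube_lift_sq (isSmooth_tcomm hG hV w hUj).continuous]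
  calc l2On (closedCube ι) (lift (tcomm G V w (partialDeriv j U))) ^ 2 ≤ (2 ^ m * T * √EU) ^ 2 :=
        pow_le_pow_left₀ (l2On_nonneg _ _) hl2 2
    _ = (2 ^ m * T) ^ 2 * EU := by rw [mul_pow, Real.sq_sqrt hEU0]

/-- **Regularity-step commutator estimate** (`m ≥ 8` on `𝕋³`): for a smooth operator-valued
`G` and a bound `E₀` there is `C ≥ 0` such that for all smooth `V, U` with
`twordEnergy (m-1) V ≤ E₀` and `twordEnergy (m-1) U ≤ E₀`, all words `|w| ≤ m` and all `j`,

  `∫_𝕋 ‖[∂^w, G(V)] ∂ⱼU‖² ≤ C · (twordEnergy m U + twordEnergy m V + 1)`,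

linear in the level-`m` energies with constants from the level-`(m-1)` bounds.
[cite: Majda1984, Ch. 2 §2.1, proof of Thm 2.1, Prop. 2.1 (2.2); Cor. 1 of Thm 2.2] -/
theorem exists_tcomm_sq_integral_le_step (hd : Fintype.card ι = 3) {G : W → (W →L[ℝ] W')}
    (hG : ContDiff ℝ ∞ G) {m : ℕ} (hm : 8 ≤ m) (E₀ : ℝ) :
    ∃ C : ℝ, 0 ≤ C ∧ ∀ V U : UnitAddTorus ι → W, IsSmooth V → IsSmooth U →
      twordEnergy (m - 1) V ≤ E₀ → twordEnergy (m - 1) U ≤ E₀ → ∀ w ∈ wordsLE ι m, ∀ j : ι,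
        ∫ x, ‖tcomm G V w (partialDeriv j U) x‖ ^ 2 ≤
          C * (twordEnergy m U + twordEnergy m V + 1) := by
  obtain ⟨Cs, hCs0, hCs⟩ := exists_norm_sq_le_twordEnergy_two (F' := W) (ι := ι) hd
  have hK : IsCompact (closedCube ι) := isCompact_closedCube
  set R₁ : ℝ := √(Cs * E₀) with hR₁_def
  set F : EuclideanSpace ℝ ι × W → (W →L[ℝ] W') := fun z => G z.2 with hF_def
  have hF : ContDiff ℝ ∞ F := hG.comp contDiff_snd
  obtain ⟨C₁, hC₁0, hC₁⟩ := exists_sup_bound_cwd_comp (ι := ι) (J := W) (m - 3) hF hK R₁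
  obtain ⟨C₂, hC₂0, hC₂⟩ := exists_tame_bound_cwd_comp (ι := ι) (J := W) m hF hK R₁
  set T : ℝ := max C₁ (R₁ * C₂) with hT_def
  have hT0 : 0 ≤ T := hC₁0.trans (le_max_left _ _)
  refine ⟨3 * (2 ^ m * T) ^ 2, by positivity, fun V U hV hU hVE hUE w hw j => ?_⟩
  have hwm : w.length ≤ m := mem_wordsLE.1 hw
  -- control of `V` from level `m - 1`, and its level-`m` size
  have hVsup : ∀ c : List ι, c.length ≤ m - 3 → ∀ y ∈ closedCube ι, ‖cwd c (lift V) y‖ ≤ R₁ :=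
    fun c hc y _ => (norm_cwd_lift_le_sqrt hCs hCs0.le hV (by omega) y).trans
      (Real.sqrt_le_sqrt (mul_le_mul_of_nonneg_left hVE hCs0.le))
  have hVsup' : ∀ c : List ι, c.length ≤ m / 2 + 1 → ∀ y ∈ closedCube ι, ‖cwd c (lift V) y‖ ≤ R₁ :=
    fun c hc => hVsup c (by omega)
  set EV : ℝ := twordEnergy m V with hEV_def
  have hEV0 : 0 ≤ EV := twordEnergy_nonneg m V
  have hVl2 : ∀ c : List ι, c.length ≤ m → l2On (closedCube ι) (cwd c (lift V)) ≤ √EV :=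
    fun c hc => l2On_cwd_lift_le_sqrt_twordEnergy hV hc
  have hGV : ContDiff ℝ ∞ fun y => G (lift V y) := hG.comp hV
  have h1 : ∀ v : List ι, v.length ≤ m - 3 → ∀ y ∈ closedCube ι,
      ‖cwd v (fun z => G (lift V z)) y‖ ≤ C₁ := hC₁ (lift V) hV hVsup
  have h2 : ∀ v : List ι, v.length ≤ m →
      l2On (closedCube ι) (cwd v (fun z => G (lift V z))) ≤ C₂ * (1 + √EV) :=
    hC₂ (lift V) hV hVsup' (√EV) (Real.sqrt_nonneg _) hVl2
  -- control of `U`: level `m` in `L²`, level `m - 1` in sup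
  set EU : ℝ := twordEnergy m U with hEU_def
  have hEU0 : 0 ≤ EU := twordEnergy_nonneg m U
  have hUj : IsSmooth (partialDeriv j U) := hU.partialDeriv j
  have hcwdU : ∀ c : List ι, cwd c (lift (partialDeriv j U)) = cwd (c ++ [j]) (lift U) := fun c => by
    rw [lift_partialDeriv_eq_cwd (hU.isContDiff (by simp)), ← cwd_append]
  have hUl2 : ∀ c : List ι, c.length + 1 ≤ m →
      l2On (closedCube ι) (cwd c (lift (partialDeriv j U))) ≤ √EU := fun c hc => by
    rw [hcwdU]
    exact l2On_cwd_lift_le_sqrt_twordEnergy hU (by simpa using hc)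
  have hUsup : ∀ c : List ι, c.length + 3 ≤ m - 1 → ∀ y, ‖cwd c (lift (partialDeriv j U)) y‖ ≤ R₁ :=
    fun c hc y => by
      rw [hcwdU]
      exact (norm_cwd_lift_le_sqrt hCs hCs0.le hU (by simp; omega) y).trans
        (Real.sqrt_le_sqrt (mul_le_mul_of_nonneg_left hUE hCs0.le))
  have hR₁0 : 0 ≤ R₁ := Real.sqrt_nonneg _
  -- the expansion
  obtain ⟨r, hr, hne⟩ := splittings_eq_cons w
  have hlen : ∀ p ∈ r, p.1.length + p.2.length = w.length := fun p hp =>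
    length_add_length_of_mem_splittings (by rw [hr]; exact List.mem_cons_of_mem _ hp)
  have hrlen : r.length ≤ 2 ^ m := length_le_two_pow_of_splittings_eq_cons hr hwm
  have hlift := lift_tcomm_eq hG hV hUj hr
  set S : ℝ := √EU + √EV + 1 with hS_def
  have hS0 : 0 ≤ S := by positivity
  -- each term
  have hterm : ∀ p ∈ r, l2On (closedCube ι)
      (fun y => cwd p.1 (fun z => G (lift V z)) y (cwd p.2 (lift (partialDeriv j U)) y)) ≤ T * S := by
    intro p hp
    have hp1 : 1 ≤ p.1.length := Nat.one_le_iff_ne_zero.2 fun h0 => hne p hp (List.eq_nil_of_length_eq_zero h0)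
    have hsum := hlen p hp
    by_cases hcase : p.1.length ≤ m - 3
    · calc l2On (closedCube ι)
            (fun y => cwd p.1 (fun z => G (lift V z)) y (cwd p.2 (lift (partialDeriv j U)) y))
          ≤ C₁ * l2On (closedCube ι) (cwd p.2 (lift (partialDeriv j U))) :=
            l2On_clm_apply_le_of_norm_le hK (h1 p.1 hcase) hC₁0 (continuous_cwd hUj _)
        _ ≤ C₁ * √EU := mul_le_mul_of_nonneg_left (hUl2 p.2 (by omega)) hC₁0
        _ ≤ T * S := by
            refine mul_le_mul (le_max_left _ _) ?_ (Real.sqrt_nonneg _) hT0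
            rw [hS_def]
            linarith [Real.sqrt_nonneg EV]
    · push Not at hcase
      calc l2On (closedCube ι)
            (fun y => cwd p.1 (fun z => G (lift V z)) y (cwd p.2 (lift (partialDeriv j U)) y))
          ≤ R₁ * l2On (closedCube ι) (cwd p.1 (fun z => G (lift V z))) :=
            l2On_clm_apply_le_of_norm_le_right hK (continuous_cwd hGV _) (hUsup p.2 (by omega)) hR₁0
        _ ≤ R₁ * (C₂ * (1 + √EV)) := mul_le_mul_of_nonneg_left (h2 p.1 (by omega)) hR₁0
        _ = R₁ * C₂ * (1 + √EV) := by ring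
        _ ≤ T * S := by
            refine mul_le_mul (le_max_right _ _) ?_ (by positivity) hT0
            rw [hS_def]
            linarith [Real.sqrt_nonneg EU]
  -- summation
  have hcont : ∀ p ∈ r, Continuous fun y =>
      cwd p.1 (fun z => G (lift V z)) y (cwd p.2 (lift (partialDeriv j U)) y) := fun p _ =>
    (continuous_cwd hGV _).clm_apply (continuous_cwd hUj _)
  have hl2 : l2On (closedCube ι) (lift (tcomm G V w (partialDeriv j U))) ≤ 2 ^ m * T * S := by
    rw [hlift]
    calc l2On (closedCube ι) (fun y =>
            (r.map fun p => cwd p.1 (fun z => G (lift V z)) y (cwd p.2 (lift (partialDeriv j U)) y)).sum)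
        ≤ (r.map fun p => l2On (closedCube ι)
            (fun y => cwd p.1 (fun z => G (lift V z)) y (cwd p.2 (lift (partialDeriv j U)) y))).sum :=
          l2On_list_sum_le hK r hcont
      _ ≤ (r.map fun _ => T * S).sum := List.sum_le_sum hterm
      _ = r.length * (T * S) := by simp [List.map_const', List.sum_replicate]
      _ ≤ 2 ^ m * (T * S) := mul_le_mul_of_nonneg_right (by exact_mod_cast hrlen) (by positivity)
      _ = 2 ^ m * T * S := by ring
  rw [← l2On_closedCube_lift_sq (isSmooth_tcomm hG hV w hUj).continuous]
  have hS2 : S ^ 2 ≤ 3 * (EU + EV + 1) := by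
    rw [hS_def]
    nlinarith [Real.sq_sqrt hEU0, Real.sq_sqrt hEV0, Real.sqrt_nonneg EU, Real.sqrt_nonneg EV,
      sq_nonneg (√EU - √EV), sq_nonneg (√EU - 1), sq_nonneg (√EV - 1)]
  calc l2On (closedCube ι) (lift (tcomm G V w (partialDeriv j U))) ^ 2 ≤ (2 ^ m * T * S) ^ 2 :=
        pow_le_pow_left₀ (l2On_nonneg _ _) hl2 2
    _ = (2 ^ m * T) ^ 2 * S ^ 2 := by ring
    _ ≤ (2 ^ m * T) ^ 2 * (3 * (EU + EV + 1)) := mul_le_mul_of_nonneg_left hS2 (by positivity)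
    _ = 3 * (2 ^ m * T) ^ 2 * (EU + EV + 1) := by ring

end Commutator

end Literature.Analysis.PDE

end
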